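import Literature.Topology.FourManifolds.GaussDiagramsStability
import Literature.Analysis.Calculus.SmoothCurveThroughSequence
import HarnessLib

/-!
# Stability of regular readings of Gauss diagrams in Banach-parameter families (openness)

Companion of `GaussDiagramsStability.lean`, towards the named fact
`Literature.Topology.FourManifolds.Knot.reidemeisterR` (genericity step of the direction `→`:
perturbing a one-parameter family of knot projections inside a finite-dimensional family of
perturbations requires the diagrams read at the endpoints to be stable under ALL small
perturbations, not only along one real parameter).

`GaussDiagramsStability.lean` proves stability along one real parameter:
`IsRegularReading.eventually_exists` — if `(Γ 0, H 0)` has a regular reading with Gauss diagram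
`G` and `Γ : ℝ → ℝ → ℝ × ℝ` is jointly `C¹` (periodic in the curve variable), `H` jointly
continuous, then `(Γ t, H t)` has a regular reading with diagram `G` for all `t` near `0`. Here the
parameter space is upgraded to an arbitrary Banach space `X` (`IsRegularReading.setOf_exists_mem_nhds`,
`IsRegularReading.isOpen_setOf_exists`): the set of parameters at which the pair has a regular
reading with diagram `G` is open. The upgrade is formal: neighbourhoods in a Banach space are
detected by `C¹` curves (`Literature.Analysis.Calculus.mem_nhds_of_forall_contDiff_curve`, from
the special curve lemma, Kriegl–Michor (1997), §2.8), and along a `C¹` curve of parameters the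
family is a jointly `C¹` one-parameter family.

## References

* V. Guillemin, A. Pollack, *Differential Topology*, AMS Chelsea (2010), Ch. 1 §6 (stability of
  transversality). [GuilleminPollack2010]
* A. Kriegl, P. W. Michor, *The Convenient Setting of Global Analysis*, AMS (1997), §2.8.
  [KrieglMichor1997]
* K. Reidemeister, *Knotentheorie*, Springer (1932), Kap. I §1. [Reidemeister1932]
-/

noncomputable section

open scoped Topology
open Filter Set Function Metric

namespace Literature.Topology.FourManifolds

namespace IsRegularReading

variable {X : Type*} [NormedAddCommGroup X] [NormedSpace ℝ X] [CompleteSpace X]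

/-- **Regular readings persist under all small perturbations, with the same diagram.** Let `X` be
a Banach space of parameters, `Γ : X → ℝ → ℝ × ℝ` jointly `C¹` with every `Γ x` `2π`-periodic,
`H : X → ℝ → ℝ` jointly continuous, and let `(Γ x₀, H x₀)` have a regular reading with Gauss
diagram `G`. Then for all `x` near `x₀` the pair `(Γ x, H x)` has a regular reading with the same
diagram `G`. (Along every `C¹` curve of parameters through `x₀` this is
`IsRegularReading.eventually_exists`; neighbourhoods are detected by `C¹` curves.)
Guillemin–Pollack (1974), Ch. 1 §6 (stability). [cite: GuilleminPollack2010, Ch. 1 §6] -/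
theorem setOf_exists_mem_nhds {Γ : X → ℝ → ℝ × ℝ} {H : X → ℝ → ℝ}
    (hΓ : ContDiff ℝ 1 (uncurry Γ)) (hH : Continuous (uncurry H))
    (hper : ∀ x, Periodic (Γ x) (2 * Real.pi)) {G : GaussDiagram} {θ₀ : Fin (2 * G.n) → ℝ}
    {x₀ : X} (h₀ : IsRegularReading (Γ x₀) (H x₀) G θ₀) :
    {x | ∃ θ, IsRegularReading (Γ x) (H x) G θ} ∈ 𝓝 x₀ := by
  refine Literature.Analysis.Calculus.mem_nhds_of_forall_contDiff_curve fun c hc hc0 ↦ ?_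
  have hΓc : ContDiff ℝ 1 (uncurry fun t ↦ Γ (c t)) := by
    have he : (uncurry fun t ↦ Γ (c t)) = uncurry Γ ∘ Prod.map c id := rfl
    rw [he]
    exact hΓ.comp (hc.prodMap contDiff_id)
  have hHc : Continuous (uncurry fun t ↦ H (c t)) := by
    have he : (uncurry fun t ↦ H (c t)) = uncurry H ∘ Prod.map c id := rfl
    rw [he]
    exact hH.comp (hc.continuous.prodMap continuous_id)
  have h₀' : IsRegularReading (Γ (c 0)) (H (c 0)) G θ₀ := by
    rw [hc0]
    exact h₀
  exact eventually_exists hΓc hHc (fun t ↦ hper (c t)) h₀'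

/-- **The parameters at which a `C¹` family of closed plane curves with heights has a regular
reading with a given Gauss diagram form an open set** (Banach space of parameters).
[cite: GuilleminPollack2010, Ch. 1 §6] -/
theorem isOpen_setOf_exists {Γ : X → ℝ → ℝ × ℝ} {H : X → ℝ → ℝ}
    (hΓ : ContDiff ℝ 1 (uncurry Γ)) (hH : Continuous (uncurry H))
    (hper : ∀ x, Periodic (Γ x) (2 * Real.pi)) (G : GaussDiagram) :
    IsOpen {x | ∃ θ, IsRegularReading (Γ x) (H x) G θ} :=
  isOpen_iff_mem_nhds.2 fun _ ⟨_, hx⟩ ↦ setOf_exists_mem_nhds hΓ hH hper hx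

/-- Pointwise form: near a parameter with a regular reading of diagram `G`, every parameter has a
regular reading of diagram `G` — for all `x` with `‖x - x₀‖ < ε`. [cite: GuilleminPollack2010, Ch. 1 §6] -/
theorem exists_forall_norm_sub_lt {Γ : X → ℝ → ℝ × ℝ} {H : X → ℝ → ℝ}
    (hΓ : ContDiff ℝ 1 (uncurry Γ)) (hH : Continuous (uncurry H))
    (hper : ∀ x, Periodic (Γ x) (2 * Real.pi)) {G : GaussDiagram} {θ₀ : Fin (2 * G.n) → ℝ}
    {x₀ : X} (h₀ : IsRegularReading (Γ x₀) (H x₀) G θ₀) :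
    ∃ ε > 0, ∀ x : X, ‖x - x₀‖ < ε → ∃ θ, IsRegularReading (Γ x) (H x) G θ := by
  obtain ⟨ε, hε, h⟩ := Metric.mem_nhds_iff.1 (setOf_exists_mem_nhds hΓ hH hper h₀)
  exact ⟨ε, hε, fun x hx ↦ h (mem_ball_iff_norm.2 hx)⟩

end IsRegularReading

end Literature.Topology.FourManifolds
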